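import Mathlib
import Summits.NavierStokesRegularity.FluidComputer.EmergenceMildDuhamel

/-!
# Stability from a mild solution: the KILL half of the linear-core test, modulo the same three analytic inputs (instab g14, cell `ns-blowup`, 2026-08-26)

HONEST FRAMING (human ruling D-0035): nothing here is a claim about Navier–Stokes blow-up.
WHAT THIS IS NOT: not NS evidence. This file is the STABLE twin of `EmergenceMildDuhamel`
(instab g13) and serves `instab/INSTAB-BRIDGE.md` l.129 (K1) — the use of a certified linear core
as a pre-registrable KEEP/KILL test for a candidate host under D-0081. `EmergenceMildDuhamel`
made the KEEP word («certified UNSTABLE eigenpair ⇒ nonlinear emergence with an amplitude floor and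
a clock») a kernel sentence conditional on three named analytic deliverables; this file does the
same for the KILL word («certified NEGATIVE Lyapunov/spectral abscissa ⇒ no autonomous hand-over
STARTS from the host»), and it forces the KILL word to carry its honest scope as a NUMBER: a
linear certificate controls only seeds below an explicit basin radius `ε₀`; finite-amplitude
seeds are not excluded by it.

Setting (abstract, as in `EmergenceMildDuhamel`): a trajectory `u : ℝ → E` in a real normed
space, an evolution family `T : ℝ → E → E`, a bilinear map `B : E → E → E`, a weaker norm
`p : E → ℝ`, and a «linear part» `ℓ : ℝ → E` (in the application `ℓ t = T t u₀`, the free linear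
evolution of the seed), entering ONLY through

* (M) the MILD FORMULA `u t − ℓ t = ∫₀ᵗ T (t − s) (B (u s) (u s)) ds` on the window, `u` continuous;
* (T) the SMOOTHING BOUND `‖T τ x‖ ≤ S τ^{−1/2} e^{ωτ} p x` (`τ > 0`) — the certified two-level
  Lyapunov constant (`LyapunovSkewCutSemigroup.norm_le_of_two_level`,
  `EmergenceMildDuhamel.smoothing_bound_of_two_level_shape`);
* (B) the BILINEAR LOSS `p (B x y) ≤ c ‖x‖ ‖y‖` (`ConvectiveProductLawLattice/Torus`);

plus a DOMINATED linear part `‖ℓ t‖ ≤ ε e^{λt}` with ANY rate `λ` above half the smoothing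
abscissa, `2λ > ω` (so a DECAY rate `λ < 0` is admissible exactly when `ω < 0`, i.e. when the
certified two-level pair is a negative certificate; in the application `ε = M_G ‖u₀‖` with the
strong-level constant `M_G = √(M/m)` of `LyapunovSkewCutSemigroup.norm_le_of_generator_form`).
With `C = S·c·√(π/(2λ − ω))` (`EmergenceBootstrap.duhamel_term_le`):

* `norm_le_of_mild` — window form, any sign of `λ`: if `C Q² ε e^{λt} < Q − 1` on `[0, T₀]`
  (`Q ≥ 1`) then `‖u t‖ ≤ Q ε e^{λt}` on `[0, T₀]` (`EmergenceBootstrap.le_mul_of_bootstrap`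
  with the improved bound `‖u t‖ ≤ ‖ℓ t‖ + ‖u t − ℓ t‖ ≤ ε e^{λt} + C (Q ε e^{λt})²`);
* `decay_of_mild` — for `λ ≤ 0` the comparison function decreases, so the threshold AT `t = 0`,
  `C Q² ε < Q − 1`, suffices: `‖u t‖ ≤ Q ε e^{λt}` on the whole window;
* `decay_two_of_mild` — `Q = 2`: every trajectory whose linear size is below the BASIN RADIUS
  `ε₀ = 1/(4C)`, i.e. `4Cε < 1`, obeys `‖u t‖ ≤ 2ε e^{λt}` — it never exceeds twice its linear size
  and decays at the rate `λ`;
* `decay_of_mild_global`, `tendsto_zero_of_mild_global` — the same for a global mild trajectory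
  (`t ≥ 0`), and `u t → 0` when `λ < 0`;
* `duhamel_const_at_quarter_rate` — the bookkeeping choice `λ = ω/4` (`ω < 0`):
  `C = S·c·√(2π/(−ω))`, so `ε₀ = 1/(4 S c √(2π/|ω|))` at decay rate `|ω|/4`.

So the (K1) KILL sentence is a kernel theorem CONDITIONAL on exactly (M)(T)(B) with the
certified numbers `(ω < 0, S, c, M_G)`, and its scope is the printed `ε₀`; nothing here is about
singularity formation. In print the statement is the «principle of linearized stability» for
semilinear parabolic problems / steady Navier–Stokes flows (Prodi 1962, Sattinger 1970,
Kirchgässner–Sorger, Yudovich; Henry 1981 Thm. 5.1.1; Kielhöfer 2012 §I.7) — here only its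
abstract Duhamel-bootstrap skeleton with explicit constants, no semigroup theory used or assumed.

Mathlib + `EmergenceMildDuhamel` (+ `EmergenceBootstrap`); no new definitions.
-/

noncomputable section

namespace Summit.NavierStokesRegularity.FluidComputer.StabilityMildDuhamel

open Set MeasureTheory intervalIntegral Filter Topology
open Summit.NavierStokesRegularity.FluidComputer.EmergenceBootstrap
open Summit.NavierStokesRegularity.FluidComputer.EmergenceMildDuhamel

variable {E : Type*} [NormedAddCommGroup E] [NormedSpace ℝ E]

/-- **A-priori control from the mild formula with a dominated linear part (window form).** Let
`T, B, p` satisfy (T) and (B) with `S, c ≥ 0` and `2λ > ω`; let `u` be continuous on `[0, T₀]`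
and satisfy the mild formula (M) about a linear part `ℓ` with `‖ℓ t‖ ≤ ε e^{λt}` (`ε > 0`) at every
`t ∈ [0, T₀]`; let `Q ≥ 1` and put `C = S·c·√(π/(2λ − ω))`. If the threshold
`C Q² ε e^{λt} < Q − 1` holds on `[0, T₀]`, then `‖u t‖ ≤ Q ε e^{λt}` for every `t ∈ [0, T₀]`.
(Any sign of `λ`; for `λ > 0` this is the upper half of `EmergenceMildDuhamel.floor_of_mild` with
the equality `‖ℓ t‖ = ε e^{λt}` weakened to an inequality.) -/
theorem norm_le_of_mild {p : E → ℝ} {T : ℝ → E → E} {B : E → E → E} {u ℓ : ℝ → E}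
    {S c Q ε lam ω T₀ : ℝ} (hS : 0 ≤ S) (hc : 0 ≤ c) (hgap : ω < 2 * lam) (hε : 0 < ε) (hQ : 1 ≤ Q)
    (hT : ∀ τ : ℝ, 0 < τ → ∀ x : E, ‖T τ x‖ ≤ S * τ ^ (-(1 / 2 : ℝ)) * Real.exp (ω * τ) * p x)
    (hB : ∀ x y : E, p (B x y) ≤ c * ‖x‖ * ‖y‖)
    (hu : ContinuousOn u (Icc 0 T₀))
    (hmild : ∀ t ∈ Icc 0 T₀, u t - ℓ t = ∫ s in (0:ℝ)..t, T (t - s) (B (u s) (u s)))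
    (hℓ : ∀ t ∈ Icc 0 T₀, ‖ℓ t‖ ≤ ε * Real.exp (lam * t))
    (hsmall : ∀ t ∈ Icc 0 T₀,
      S * c * Real.sqrt (Real.pi / (2 * lam - ω)) * Q ^ 2 * (ε * Real.exp (lam * t)) < Q - 1) :
    ∀ t ∈ Icc 0 T₀, ‖u t‖ ≤ Q * (ε * Real.exp (lam * t)) := by
  set C : ℝ := S * c * Real.sqrt (Real.pi / (2 * lam - ω)) with hC
  intro t ht
  have hT₀ : 0 ≤ T₀ := ht.1.trans ht.2
  -- the data of `le_mul_of_bootstrap` with f = ‖u ·‖, a = ε e^{λ·}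
  have hf : ContinuousOn (fun t => ‖u t‖) (Icc 0 T₀) := continuous_norm.comp_continuousOn hu
  have ha : ContinuousOn (fun t => ε * Real.exp (lam * t)) (Icc 0 T₀) :=
    (by fun_prop : Continuous fun t => ε * Real.exp (lam * t)).continuousOn
  have h0 : ‖u 0‖ ≤ Q * (ε * Real.exp (lam * 0)) := by
    have hm := hmild 0 ⟨le_rfl, hT₀⟩
    rw [intervalIntegral.integral_same, sub_eq_zero] at hm
    rw [hm]
    have h1 := hℓ 0 ⟨le_rfl, hT₀⟩
    have : 0 ≤ ε * Real.exp (lam * 0) := by positivity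
    nlinarith
  -- the improved bound: triangle inequality about the linear part + the Duhamel deviation bound
  have hboot : ∀ t ∈ Icc 0 T₀, (∀ s ∈ Icc 0 t, ‖u s‖ ≤ Q * (ε * Real.exp (lam * s))) →
      ‖u t‖ ≤ ε * Real.exp (lam * t) + C * (Q * (ε * Real.exp (lam * t))) ^ 2 := by
    intro t ht hap
    have hap' : ∀ s ∈ Icc 0 t, ‖u s‖ ≤ Q * ε * Real.exp (lam * s) := fun s hs => by
      rw [mul_assoc]; exact hap s hs
    have h := norm_sub_le_of_mild hS hc hgap ht.1 hT hB (hmild t ht) hap'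
    have e : (Q * ε * Real.exp (lam * t)) ^ 2 = (Q * (ε * Real.exp (lam * t))) ^ 2 := by ring
    rw [e] at h
    calc ‖u t‖ ≤ ‖ℓ t‖ + ‖u t - ℓ t‖ := norm_le_insert' (u t) (ℓ t)
      _ ≤ ε * Real.exp (lam * t) + C * (Q * (ε * Real.exp (lam * t))) ^ 2 :=
          add_le_add (hℓ t ht) (by rw [hC]; exact h)
  have hsmall' : ∀ t ∈ Icc 0 T₀, 0 < ε * Real.exp (lam * t) ∧
      C * Q ^ 2 * (ε * Real.exp (lam * t)) < Q - 1 := fun t ht =>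
    ⟨by positivity, by rw [hC]; exact hsmall t ht⟩
  exact le_mul_of_bootstrap (f := fun t => ‖u t‖) (a := fun t => ε * Real.exp (lam * t))
    (T := T₀) (Q := Q) (C := C) hf ha h0 hboot hsmall' t ht

/-- **Nonlinear exponential stability from a decaying linear part (INSTAB-BRIDGE l.129 (K1), the
KILL half), conditional on (M)(T)(B).** In the setting of `norm_le_of_mild` with a rate `λ ≤ 0`
(admissible iff the smoothing abscissa is negative, `ω < 2λ ≤ 0`), the comparison function
`ε e^{λt}` is non-increasing, so the threshold at the initial time alone, `C Q² ε < Q − 1`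
(`C = S·c·√(π/(2λ − ω))`), gives `‖u t‖ ≤ Q ε e^{λt}` on the whole window `[0, T₀]` — whatever
its length. -/
theorem decay_of_mild {p : E → ℝ} {T : ℝ → E → E} {B : E → E → E} {u ℓ : ℝ → E}
    {S c Q ε lam ω T₀ : ℝ} (hS : 0 ≤ S) (hc : 0 ≤ c) (hgap : ω < 2 * lam) (hlam : lam ≤ 0)
    (hε : 0 < ε) (hQ : 1 ≤ Q)
    (hT : ∀ τ : ℝ, 0 < τ → ∀ x : E, ‖T τ x‖ ≤ S * τ ^ (-(1 / 2 : ℝ)) * Real.exp (ω * τ) * p x)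
    (hB : ∀ x y : E, p (B x y) ≤ c * ‖x‖ * ‖y‖)
    (hu : ContinuousOn u (Icc 0 T₀))
    (hmild : ∀ t ∈ Icc 0 T₀, u t - ℓ t = ∫ s in (0:ℝ)..t, T (t - s) (B (u s) (u s)))
    (hℓ : ∀ t ∈ Icc 0 T₀, ‖ℓ t‖ ≤ ε * Real.exp (lam * t))
    (hsmall : S * c * Real.sqrt (Real.pi / (2 * lam - ω)) * Q ^ 2 * ε < Q - 1) :
    ∀ t ∈ Icc 0 T₀, ‖u t‖ ≤ Q * (ε * Real.exp (lam * t)) := by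
  refine norm_le_of_mild hS hc hgap hε hQ hT hB hu hmild hℓ ?_
  intro t ht
  have hlt : lam * t ≤ 0 := by nlinarith [ht.1, hlam]
  have hexp : Real.exp (lam * t) ≤ 1 := Real.exp_le_one_iff.mpr hlt
  have hC0 : 0 ≤ S * c * Real.sqrt (Real.pi / (2 * lam - ω)) * Q ^ 2 * ε := by positivity
  calc S * c * Real.sqrt (Real.pi / (2 * lam - ω)) * Q ^ 2 * (ε * Real.exp (lam * t))
      = (S * c * Real.sqrt (Real.pi / (2 * lam - ω)) * Q ^ 2 * ε) * Real.exp (lam * t) := by ring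
    _ ≤ (S * c * Real.sqrt (Real.pi / (2 * lam - ω)) * Q ^ 2 * ε) * 1 :=
        mul_le_mul_of_nonneg_left hexp hC0
    _ = S * c * Real.sqrt (Real.pi / (2 * lam - ω)) * Q ^ 2 * ε := by ring
    _ < Q - 1 := hsmall

/-- **The basin radius (Q = 2): `ε₀ = 1/(4C)`.** In the setting of `decay_of_mild`, every mild
trajectory whose linear part has size `ε` below the basin radius, `4Cε < 1` with
`C = S·c·√(π/(2λ − ω))`, satisfies `‖u t‖ ≤ 2ε e^{λt}` on the whole window: it never exceeds twice
its linear size and decays at the certified rate `λ ≤ 0`. THIS is the honest content of a linear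
KILL word: seeds of linear size `≥ ε₀` (finite-amplitude perturbations) are not excluded by it, so
a pre-registered KILL test must print `ε₀(S, c, ω, λ)` next to the abscissa. -/
theorem decay_two_of_mild {p : E → ℝ} {T : ℝ → E → E} {B : E → E → E} {u ℓ : ℝ → E}
    {S c ε lam ω T₀ : ℝ} (hS : 0 ≤ S) (hc : 0 ≤ c) (hgap : ω < 2 * lam) (hlam : lam ≤ 0)
    (hε : 0 < ε)
    (hT : ∀ τ : ℝ, 0 < τ → ∀ x : E, ‖T τ x‖ ≤ S * τ ^ (-(1 / 2 : ℝ)) * Real.exp (ω * τ) * p x)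
    (hB : ∀ x y : E, p (B x y) ≤ c * ‖x‖ * ‖y‖)
    (hu : ContinuousOn u (Icc 0 T₀))
    (hmild : ∀ t ∈ Icc 0 T₀, u t - ℓ t = ∫ s in (0:ℝ)..t, T (t - s) (B (u s) (u s)))
    (hℓ : ∀ t ∈ Icc 0 T₀, ‖ℓ t‖ ≤ ε * Real.exp (lam * t))
    (hbasin : 4 * (S * c * Real.sqrt (Real.pi / (2 * lam - ω))) * ε < 1) :
    ∀ t ∈ Icc 0 T₀, ‖u t‖ ≤ 2 * (ε * Real.exp (lam * t)) := by
  refine decay_of_mild hS hc hgap hlam hε (by norm_num : (1:ℝ) ≤ 2) hT hB hu hmild hℓ ?_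
  have e : S * c * Real.sqrt (Real.pi / (2 * lam - ω)) * (2:ℝ) ^ 2 * ε
      = 4 * (S * c * Real.sqrt (Real.pi / (2 * lam - ω))) * ε := by ring
  rw [e]
  linarith

/-- **Global form.** If `u` is a GLOBAL mild trajectory — continuous on `[0, ∞)`, satisfying (M)
about a linear part with `‖ℓ t‖ ≤ ε e^{λt}` for all `t ≥ 0` — and the initial threshold
`C Q² ε < Q − 1` holds (`λ ≤ 0`, `2λ > ω`), then `‖u t‖ ≤ Q ε e^{λt}` for every `t ≥ 0`. -/
theorem decay_of_mild_global {p : E → ℝ} {T : ℝ → E → E} {B : E → E → E} {u ℓ : ℝ → E}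
    {S c Q ε lam ω : ℝ} (hS : 0 ≤ S) (hc : 0 ≤ c) (hgap : ω < 2 * lam) (hlam : lam ≤ 0)
    (hε : 0 < ε) (hQ : 1 ≤ Q)
    (hT : ∀ τ : ℝ, 0 < τ → ∀ x : E, ‖T τ x‖ ≤ S * τ ^ (-(1 / 2 : ℝ)) * Real.exp (ω * τ) * p x)
    (hB : ∀ x y : E, p (B x y) ≤ c * ‖x‖ * ‖y‖)
    (hu : ContinuousOn u (Ici 0))
    (hmild : ∀ t : ℝ, 0 ≤ t → u t - ℓ t = ∫ s in (0:ℝ)..t, T (t - s) (B (u s) (u s)))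
    (hℓ : ∀ t : ℝ, 0 ≤ t → ‖ℓ t‖ ≤ ε * Real.exp (lam * t))
    (hsmall : S * c * Real.sqrt (Real.pi / (2 * lam - ω)) * Q ^ 2 * ε < Q - 1) :
    ∀ t : ℝ, 0 ≤ t → ‖u t‖ ≤ Q * (ε * Real.exp (lam * t)) := by
  intro t ht
  exact decay_of_mild (T₀ := t) hS hc hgap hlam hε hQ hT hB (hu.mono Icc_subset_Ici_self)
    (fun s hs => hmild s hs.1) (fun s hs => hℓ s hs.1) hsmall t ⟨ht, le_rfl⟩

/-- **Asymptotic stability.** Under the hypotheses of `decay_of_mild_global` with a STRICTLY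
negative rate `λ < 0`, the perturbation dies: `u t → 0` as `t → ∞`. -/
theorem tendsto_zero_of_mild_global {p : E → ℝ} {T : ℝ → E → E} {B : E → E → E} {u ℓ : ℝ → E}
    {S c Q ε lam ω : ℝ} (hS : 0 ≤ S) (hc : 0 ≤ c) (hgap : ω < 2 * lam) (hlam : lam < 0)
    (hε : 0 < ε) (hQ : 1 ≤ Q)
    (hT : ∀ τ : ℝ, 0 < τ → ∀ x : E, ‖T τ x‖ ≤ S * τ ^ (-(1 / 2 : ℝ)) * Real.exp (ω * τ) * p x)
    (hB : ∀ x y : E, p (B x y) ≤ c * ‖x‖ * ‖y‖)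
    (hu : ContinuousOn u (Ici 0))
    (hmild : ∀ t : ℝ, 0 ≤ t → u t - ℓ t = ∫ s in (0:ℝ)..t, T (t - s) (B (u s) (u s)))
    (hℓ : ∀ t : ℝ, 0 ≤ t → ‖ℓ t‖ ≤ ε * Real.exp (lam * t))
    (hsmall : S * c * Real.sqrt (Real.pi / (2 * lam - ω)) * Q ^ 2 * ε < Q - 1) :
    Tendsto u atTop (𝓝 0) := by
  have hb := decay_of_mild_global hS hc hgap hlam.le hε hQ hT hB hu hmild hℓ hsmall
  have hlim : Tendsto (fun t : ℝ => Q * (ε * Real.exp (lam * t))) atTop (𝓝 0) := by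
    have h1 : Tendsto (fun t : ℝ => lam * t) atTop atBot :=
      Tendsto.const_mul_atTop_of_neg hlam tendsto_id
    have h2 : Tendsto (fun t : ℝ => Real.exp (lam * t)) atTop (𝓝 0) :=
      Real.tendsto_exp_atBot.comp h1
    have h3 := (h2.const_mul ε).const_mul Q
    simpa using h3
  refine squeeze_zero_norm' ?_ hlim
  filter_upwards [eventually_ge_atTop (0:ℝ)] with t ht using hb t ht

omit [NormedSpace ℝ E] in
/-- **Monotonicity of the linear bound in the rate.** A linear part certified at a strong-level
abscissa `ω₁` — `‖ℓ t‖ ≤ M δ e^{ω₁ t}` (`M, δ ≥ 0`; in the application `ℓ t = T t u₀`, `δ = ‖u₀‖`,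
`M = √(M/m)` of `LyapunovSkewCutSemigroup.norm_le_of_generator_form`) — is dominated at every slower
rate `λ ≥ ω₁` on `t ≥ 0`: `‖ℓ t‖ ≤ (M δ) e^{λt}`. (So the rate `λ` in `decay_of_mild` may be chosen
anywhere in `[ω₁, 0] ∩ (ω/2, 0]`, trading decay rate against the constant `C(λ)`.) -/
theorem linear_bound_mono {ℓt : E} {M δ ω₁ lam t : ℝ} (hM : 0 ≤ M) (hδ : 0 ≤ δ) (ht : 0 ≤ t)
    (hrate : ω₁ ≤ lam) (h : ‖ℓt‖ ≤ M * δ * Real.exp (ω₁ * t)) :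
    ‖ℓt‖ ≤ (M * δ) * Real.exp (lam * t) := by
  have hexp : Real.exp (ω₁ * t) ≤ Real.exp (lam * t) :=
    Real.exp_le_exp.mpr (mul_le_mul_of_nonneg_right hrate ht)
  exact h.trans (mul_le_mul_of_nonneg_left hexp (by positivity))

/-- **The bookkeeping choice `λ = ω/4` for a negative certificate.** For `ω < 0` the rate
`λ = ω/4` is admissible (`2λ = ω/2 > ω`, `λ < 0`) and the Duhamel constant reads
`C = S·c·√(π/(2λ − ω)) = S·c·√(2π/(−ω))` — so the basin radius of `decay_two_of_mild` is
`ε₀ = 1/(4 S c √(2π/|ω|))` at decay rate `|ω|/4`. -/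
theorem duhamel_const_at_quarter_rate (S c ω : ℝ) :
    S * c * Real.sqrt (Real.pi / (2 * (ω / 4) - ω)) = S * c * Real.sqrt (2 * Real.pi / (-ω)) := by
  have h1 : 2 * (ω / 4) - ω = -ω / 2 := by ring
  have e : Real.pi / (2 * (ω / 4) - ω) = 2 * Real.pi / (-ω) := by
    rw [h1, div_div_eq_mul_div]; ring
  rw [e]

/-- The rate `λ = ω/4` satisfies the two side conditions of `decay_of_mild` when `ω < 0`:
the gap `ω < 2λ` and the sign `λ ≤ 0` (indeed `λ < 0`). -/
theorem quarter_rate_admissible {ω : ℝ} (hω : ω < 0) : ω < 2 * (ω / 4) ∧ ω / 4 < 0 := by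
  constructor <;> linarith

end Summit.NavierStokesRegularity.FluidComputer.StabilityMildDuhamel

end
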